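import Summits.AnomalousDissipation.AnomalousDissipation.Theorems.DegreeGateFrontHeadRungsFourier

/-!
# DegreeGate — front readout HEADS: part 2 of 3 (§3 Fourier support and Poincaré constants, §4 the forcing shell)

Part 2 of the lens-5 g65 kernel `DegreeGateFrontHeadRungs`; imports part 1. Namespace `…Theorems.DegreeGate`; declarations byte-identical
to the landable. [cite: FMRTTurbulence2001, Ch. II] [folklore]
-/

noncomputable section

set_option linter.dupNamespace false
set_option linter.style.longLine false

open MeasureTheory Filter UnitAddTorus
open scoped InnerProductSpace ComplexConjugate ENNReal
open Literature.Analysis Literature.Analysis.FunctionSpaces Literature.Analysis.FunctionSpaces.Torus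
open Summit.AnomalousDissipation.AnomalousDissipation.Theorems.TaylorGreenLoudGalerkinStates
open Summit.AnomalousDissipation.AnomalousDissipation.Theorems.TaylorGreenLoudGalerkinStates.Negative

namespace Summit.AnomalousDissipation.AnomalousDissipation.Theorems.DegreeGate

/-- The `L²(T³; ℝ³)` classes (local shorthand, not a definition). -/
local notation "𝐋" => MeasureTheory.Lp (EuclideanSpace ℝ (Fin 3)) 2 (MeasureTheory.volume : MeasureTheory.Measure (UnitAddTorus (Fin 3)))

/-! ### §3 Fourier support of the Taylor–Green class and the two Poincaré constants

For `U ∈ H` (mean zero, weakly divergence-free) invariant under the two half-period shifts, `Û(k) = 0` unless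
`k₀ ≡ k₁ ≡ k₂ (mod 2)` and `k ≠ 0`, whence `|k|² ≥ 3` on the support (`λ₁ = 12π²`); with the three mirrors in
addition, frequencies with at most one non-zero coordinate are killed by `Û(k)_j = 0 (k_j = 0)` plus `k · Û(k) = 0`,
so off the forcing shell `{±1}³` the support has `|k|² ≥ 8` (`λ = 32π²`). -/

/-- Mirrors: `Û(k)_j = 0` whenever `k_j = 0`. [folklore] -/
theorem fc_apply_eq_zero_of_coord (U : 𝐋)
    (hM : ∀ i j : Fin 3, (fun x => (U : UnitAddTorus (Fin 3) → EuclideanSpace ℝ (Fin 3)) (Function.update x i (-x i)) j) =ᵐ[volume]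
      (fun x => if j = i then -((U : UnitAddTorus (Fin 3) → EuclideanSpace ℝ (Fin 3)) x j) else (U : UnitAddTorus (Fin 3) → EuclideanSpace ℝ (Fin 3)) x j))
    {k : Fin 3 → ℤ} {j : Fin 3} (hkj : k j = 0) : fc U k j = 0 := by
  have e : Function.update k j (-k j) = k := by
    funext l
    by_cases hl : l = j
    · subst hl
      rw [Function.update_self, hkj, neg_zero]
    · rw [Function.update_of_ne hl]
  have h := fc_update_neg_apply U (hM j j) k
  rw [e, if_pos rfl] at h
  linear_combination (1/2 : ℂ) * h

/-- Mirrors + incompressibility: a frequency with at most one non-zero coordinate carries nothing. [folklore] -/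
theorem fc_eq_zero_of_axis {U : 𝐋} (hU : U ∈ energySpace (Fin 3))
    (hM : ∀ i j : Fin 3, (fun x => (U : UnitAddTorus (Fin 3) → EuclideanSpace ℝ (Fin 3)) (Function.update x i (-x i)) j) =ᵐ[volume]
      (fun x => if j = i then -((U : UnitAddTorus (Fin 3) → EuclideanSpace ℝ (Fin 3)) x j) else (U : UnitAddTorus (Fin 3) → EuclideanSpace ℝ (Fin 3)) x j))
    {k : Fin 3 → ℤ} {i : Fin 3} (hk : ∀ l, l ≠ i → k l = 0) : fc U k = 0 := by
  ext j
  rw [show (0 : EuclideanSpace ℂ (Fin 3)) j = 0 from rfl]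
  by_cases hj : j = i
  · subst hj
    have hdiv := sum_mul_fc hU k
    rw [Finset.sum_eq_single j (fun l _ hl => by rw [hk l hl, Int.cast_zero, zero_mul])
      (fun h => absurd (Finset.mem_univ j) h)] at hdiv
    rcases mul_eq_zero.1 hdiv with h0 | h0
    · exact fc_apply_eq_zero_of_coord U hM (by exact_mod_cast h0)
    · exact h0
  · exact fc_apply_eq_zero_of_coord U hM (hk j hj)

/-- Mirrors: flipping the sign of one coordinate of `k` does not change `‖Û(k)‖`. [folklore] -/
theorem norm_fc_update_neg (U : 𝐋)
    (hM : ∀ i j : Fin 3, (fun x => (U : UnitAddTorus (Fin 3) → EuclideanSpace ℝ (Fin 3)) (Function.update x i (-x i)) j) =ᵐ[volume]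
      (fun x => if j = i then -((U : UnitAddTorus (Fin 3) → EuclideanSpace ℝ (Fin 3)) x j) else (U : UnitAddTorus (Fin 3) → EuclideanSpace ℝ (Fin 3)) x j))
    (i : Fin 3) (k : Fin 3 → ℤ) : ‖fc U (Function.update k i (-k i))‖ = ‖fc U k‖ := by
  rw [EuclideanSpace.norm_eq, EuclideanSpace.norm_eq]
  congr 1
  refine Finset.sum_congr rfl fun j _ => ?_
  rw [fc_update_neg_apply U (hM i j) k, norm_mul]
  split_ifs <;> simp

/-- **Support trichotomy in the Taylor–Green class**: for `U ∈ H` with the three mirrors and the two half-shifts,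
every frequency either carries nothing, or lies on the forcing shell `{±1}³`, or has `|k|² ≥ 8`. [folklore] -/
theorem fc_eq_zero_or {U : 𝐋} (hU : U ∈ energySpace (Fin 3))
    (hM : ∀ i j : Fin 3, (fun x => (U : UnitAddTorus (Fin 3) → EuclideanSpace ℝ (Fin 3)) (Function.update x i (-x i)) j) =ᵐ[volume]
      (fun x => if j = i then -((U : UnitAddTorus (Fin 3) → EuclideanSpace ℝ (Fin 3)) x j) else (U : UnitAddTorus (Fin 3) → EuclideanSpace ℝ (Fin 3)) x j))
    (hS1 : (fun x => (U : UnitAddTorus (Fin 3) → EuclideanSpace ℝ (Fin 3)) (x + (Pi.single (0 : Fin 3) (((1/2 : ℝ)) : UnitAddCircle) + Pi.single (1 : Fin 3) (((1/2 : ℝ)) : UnitAddCircle)))) =ᵐ[volume] (U : UnitAddTorus (Fin 3) → EuclideanSpace ℝ (Fin 3)))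
    (hS2 : (fun x => (U : UnitAddTorus (Fin 3) → EuclideanSpace ℝ (Fin 3)) (x + (Pi.single (0 : Fin 3) (((1/2 : ℝ)) : UnitAddCircle) + Pi.single (2 : Fin 3) (((1/2 : ℝ)) : UnitAddCircle)))) =ᵐ[volume] (U : UnitAddTorus (Fin 3) → EuclideanSpace ℝ (Fin 3)))
    (k : Fin 3 → ℤ) : fc U k = 0 ∨ k ∈ tgShell ∨ (8 : ℤ) ≤ k 0 ^ 2 + k 1 ^ 2 + k 2 ^ 2 := by
  by_cases h01 : Even (k 0 + k 1)
  · by_cases h02 : Even (k 0 + k 2)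
    · rcases tgShell_or_eight_le_or_axis k h01 h02 with h | h | ⟨i, hi⟩
      · exact Or.inr (Or.inl h)
      · exact Or.inr (Or.inr h)
      · exact Or.inl (fc_eq_zero_of_axis hU hM hi)
    · exact Or.inl (fc_eq_zero_of_halfShift U hS2 (Int.not_even_iff_odd.1 h02))
  · exact Or.inl (fc_eq_zero_of_halfShift U hS1 (Int.not_even_iff_odd.1 h01))

/-- Slim support dichotomy: for `U ∈ H` with the two half-shifts, every frequency either carries nothing or has
`|k|² ≥ 3`. [folklore] -/
theorem fc_eq_zero_or_three_le {U : 𝐋} (hU : U ∈ energySpace (Fin 3))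
    (hS1 : (fun x => (U : UnitAddTorus (Fin 3) → EuclideanSpace ℝ (Fin 3)) (x + (Pi.single (0 : Fin 3) (((1/2 : ℝ)) : UnitAddCircle) + Pi.single (1 : Fin 3) (((1/2 : ℝ)) : UnitAddCircle)))) =ᵐ[volume] (U : UnitAddTorus (Fin 3) → EuclideanSpace ℝ (Fin 3)))
    (hS2 : (fun x => (U : UnitAddTorus (Fin 3) → EuclideanSpace ℝ (Fin 3)) (x + (Pi.single (0 : Fin 3) (((1/2 : ℝ)) : UnitAddCircle) + Pi.single (2 : Fin 3) (((1/2 : ℝ)) : UnitAddCircle)))) =ᵐ[volume] (U : UnitAddTorus (Fin 3) → EuclideanSpace ℝ (Fin 3)))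
    (k : Fin 3 → ℤ) : fc U k = 0 ∨ (3 : ℤ) ≤ k 0 ^ 2 + k 1 ^ 2 + k 2 ^ 2 := by
  by_cases h01 : Even (k 0 + k 1)
  · by_cases h02 : Even (k 0 + k 2)
    · by_cases hk : k = 0
      · left
        rw [hk]
        exact fc_zero hU
      · exact Or.inr (three_le_of_parity k h01 h02 hk)
    · exact Or.inl (fc_eq_zero_of_halfShift U hS2 (Int.not_even_iff_odd.1 h02))
  · exact Or.inl (fc_eq_zero_of_halfShift U hS1 (Int.not_even_iff_odd.1 h01))

/-- Parseval in `ℝ≥0∞`: `Σ' ‖Û(k)‖ₑ² = ∫|U|²`. [folklore] -/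
theorem tsum_enorm_sq_fc (U : 𝐋) : ∑' k, ‖fc U k‖ₑ ^ 2 = ENNReal.ofReal (∫ x, ‖U x‖ ^ 2) := by
  rw [Literature.Analysis.FluidPDE.Torus.integral_norm_sq_coe_eq, ENNReal.ofReal_pow (norm_nonneg _), ofReal_norm]
  exact (Literature.Analysis.FluidPDE.Torus.enorm_sq_coe_eq_tsum U).symm

/-- **Spectral-gap bookkeeping** (`‖∇U‖² = 4π² Σ |k|² ‖Û(k)‖²`): if every frequency carrying energy has `|k|² ≥ m`,
except possibly those of a finite set `S` on which `|k|² + b ≥ m`, then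
`4π² m ∫|U|² ≤ ‖∇U‖² + 4π² b Σ_{k ∈ S} ‖Û(k)‖²`. [folklore] -/
theorem spectral_gap_bookkeeping (U : 𝐋) (hfin : eGradNormSq (U : UnitAddTorus (Fin 3) → EuclideanSpace ℝ (Fin 3)) ≠ ⊤)
    {m b : ℝ} (hm : 0 ≤ m) (hb : 0 ≤ b) (S : Finset (Fin 3 → ℤ))
    (hterm : ∀ k, fc U k = 0 ∨ (k ∈ S ∧ m ≤ freqNormSq k + b) ∨ m ≤ freqNormSq k) :
    4 * Real.pi ^ 2 * (m * ∫ x, ‖U x‖ ^ 2) ≤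
      (eGradNormSq (U : UnitAddTorus (Fin 3) → EuclideanSpace ℝ (Fin 3))).toReal + 4 * Real.pi ^ 2 * (b * ∑ k ∈ S, ‖fc U k‖ ^ 2) := by
  set c : (Fin 3 → ℤ) → ℝ≥0∞ := fun k => ‖fc U k‖ₑ ^ 2 with hc
  have hterm' : ∀ k, ENNReal.ofReal m * c k ≤
      ENNReal.ofReal (freqNormSq k) * c k + ENNReal.ofReal b * (if k ∈ S then c k else 0) := by
    intro k
    rcases hterm k with h0 | ⟨hS, hle⟩ | hle
    · have : c k = 0 := by simp [hc, h0]
      simp [this]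
    · rw [if_pos hS, ← add_mul]
      refine mul_le_mul_of_nonneg_right ?_ bot_le
      rw [← ENNReal.ofReal_add (freqNormSq_nonneg k) hb]
      exact ENNReal.ofReal_le_ofReal hle
    · exact (mul_le_mul_of_nonneg_right (ENNReal.ofReal_le_ofReal hle) bot_le).trans le_self_add
  have e1 : ∑' k, (if k ∈ S then c k else 0) = ∑ k ∈ S, c k := by
    rw [tsum_eq_sum (s := S) (fun k hk => if_neg hk)]
    exact Finset.sum_congr rfl (fun k hk => if_pos hk)
  have hsum : ENNReal.ofReal m * ∑' k, c k ≤
      (∑' k, ENNReal.ofReal (freqNormSq k) * c k) + ENNReal.ofReal b * ∑ k ∈ S, c k := by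
    calc ENNReal.ofReal m * ∑' k, c k = ∑' k, ENNReal.ofReal m * c k := ENNReal.tsum_mul_left.symm
      _ ≤ ∑' k, (ENNReal.ofReal (freqNormSq k) * c k + ENNReal.ofReal b * (if k ∈ S then c k else 0)) :=
          ENNReal.tsum_le_tsum hterm'
      _ = (∑' k, ENNReal.ofReal (freqNormSq k) * c k) + ENNReal.ofReal b * ∑ k ∈ S, c k := by
          rw [ENNReal.tsum_add, ENNReal.tsum_mul_left, e1]
  have hE : ∑' k, c k = ENNReal.ofReal (∫ x, ‖U x‖ ^ 2) := tsum_enorm_sq_fc U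
  have hG : eGradNormSq (U : UnitAddTorus (Fin 3) → EuclideanSpace ℝ (Fin 3)) =
      ENNReal.ofReal (4 * Real.pi ^ 2) * ∑' k, ENNReal.ofReal (freqNormSq k) * c k := eGradNormSq_eq_tsum _
  have hS : ∑ k ∈ S, c k = ENNReal.ofReal (∑ k ∈ S, ‖fc U k‖ ^ 2) := by
    rw [ENNReal.ofReal_sum_of_nonneg (fun k _ => sq_nonneg _)]
    refine Finset.sum_congr rfl fun k _ => ?_
    show ‖fc U k‖ₑ ^ 2 = ENNReal.ofReal (‖fc U k‖ ^ 2)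
    rw [← ofReal_norm, ENNReal.ofReal_pow (norm_nonneg _)]
  have hπ : 0 ≤ 4 * Real.pi ^ 2 := by positivity
  have h4 : ENNReal.ofReal (4 * Real.pi ^ 2 * (m * ∫ x, ‖U x‖ ^ 2)) ≤
      eGradNormSq (U : UnitAddTorus (Fin 3) → EuclideanSpace ℝ (Fin 3)) +
        ENNReal.ofReal (4 * Real.pi ^ 2 * (b * ∑ k ∈ S, ‖fc U k‖ ^ 2)) := by
    rw [ENNReal.ofReal_mul hπ, ENNReal.ofReal_mul hπ, ENNReal.ofReal_mul hm, ← hE, ENNReal.ofReal_mul hb, ← hS, hG,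
      ← mul_add]
    exact mul_le_mul_of_nonneg_left hsum bot_le
  have hne : eGradNormSq (U : UnitAddTorus (Fin 3) → EuclideanSpace ℝ (Fin 3)) +
      ENNReal.ofReal (4 * Real.pi ^ 2 * (b * ∑ k ∈ S, ‖fc U k‖ ^ 2)) ≠ ⊤ :=
    ENNReal.add_ne_top.2 ⟨hfin, ENNReal.ofReal_ne_top⟩
  have h5 := (ENNReal.ofReal_le_iff_le_toReal hne).1 h4
  rwa [ENNReal.toReal_add hfin ENNReal.ofReal_ne_top, ENNReal.toReal_ofReal (by positivity)] at h5

/-! ### §4 The forcing shell: `Σ_{k ∈ {±1}³} ‖Û(k)‖² = 4 (U, f_TG)²` in the Taylor–Green class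

With the mirrors and the quarter turn the eight shell coefficients are determined by `a = Û(1,1,1)`, and `a` itself
by the single real number `Im a₀` (`a₁ = −a₀`, `a₂ = 0`, `Re a₀ = 0`); both `Σ_{shell} ‖Û(k)‖²` and `(U, f_TG)` are
then explicit multiples of `(Im a₀)²` resp. `Im a₀`. -/

/-- A sign-flip–invariant function on `ℤ³` is constant on the shell `{±1}³`, so its shell sum is `8 ×` its value
at `(1, 1, 1)`. [folklore] -/
theorem sum_tgShell_eq_of_flip_invariant {M : Type*} [AddCommMonoid M] (g : (Fin 3 → ℤ) → M)
    (hg : ∀ (i : Fin 3) (k : Fin 3 → ℤ), g (Function.update k i (-k i)) = g k) :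
    ∑ k ∈ tgShell, g k = 8 • g (fun _ => 1) := by
  have h1 : ∀ k ∈ tgShell, ∀ i, g (Function.update k i 1) = g k := by
    intro k hk i
    rcases (mem_tgShell_iff k).1 hk i with h | h
    · rw [← h, Function.update_eq_self]
    · have e : Function.update k i 1 = Function.update k i (-k i) := by rw [h, neg_neg]
      rw [e, hg]
  have hmem : ∀ k ∈ tgShell, ∀ i, Function.update k i 1 ∈ tgShell := by
    intro k hk i
    rw [mem_tgShell_iff] at hk ⊢
    intro l
    by_cases hl : l = i
    · subst hl
      exact Or.inl (Function.update_self ..)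
    · rw [Function.update_of_ne hl]
      exact hk l
  have h2 : ∀ k ∈ tgShell, g k = g (fun _ => 1) := by
    intro k hk
    have e : (fun _ => (1 : ℤ)) = Function.update (Function.update (Function.update k 0 1) 1 1) 2 1 := by
      funext l
      fin_cases l <;> simp
    rw [e, h1 _ (hmem _ (hmem _ hk 0) 1) 2, h1 _ (hmem _ hk 0) 1, h1 _ hk 0]
  rw [Finset.sum_congr rfl h2, Finset.sum_const, card_tgShell]

/-- The Fourier coefficients of `f_TG` flip like a mirror-odd field: `f̂(R_i k)_j = ∓ f̂(k)_j`. [folklore] -/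
theorem tgCoeff_update_neg_apply (k : Fin 3 → ℤ) (i j : Fin 3) :
    tgCoeff (Function.update k i (-k i)) j = (if j = i then -1 else 1) * tgCoeff k j := by
  fin_cases i <;> fin_cases j <;> simp [tgCoeff]

/-- Mirrors: `⟪f̂(k), Û(k)⟫` is invariant under the sign flips of `k`. [folklore] -/
theorem inner_tgCoeff_fc_update_neg (U : 𝐋)
    (hM : ∀ i j : Fin 3, (fun x => (U : UnitAddTorus (Fin 3) → EuclideanSpace ℝ (Fin 3)) (Function.update x i (-x i)) j) =ᵐ[volume]
      (fun x => if j = i then -((U : UnitAddTorus (Fin 3) → EuclideanSpace ℝ (Fin 3)) x j) else (U : UnitAddTorus (Fin 3) → EuclideanSpace ℝ (Fin 3)) x j))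
    (i : Fin 3) (k : Fin 3 → ℤ) :
    inner ℂ (tgCoeff (Function.update k i (-k i))) (fc U (Function.update k i (-k i))) = inner ℂ (tgCoeff k) (fc U k) := by
  simp only [PiLp.inner_apply, RCLike.inner_apply]
  refine Finset.sum_congr rfl fun j _ => ?_
  rw [fc_update_neg_apply U (hM i j) k, tgCoeff_update_neg_apply]
  split_ifs <;> simp

/-- Three mirrors compose to `k ↦ −k` with sign `−` on the `0`-th component: `Û(−k)₀ = −Û(k)₀`. [folklore] -/
theorem fc_neg_apply_zero (U : 𝐋)
    (hM : ∀ i j : Fin 3, (fun x => (U : UnitAddTorus (Fin 3) → EuclideanSpace ℝ (Fin 3)) (Function.update x i (-x i)) j) =ᵐ[volume]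
      (fun x => if j = i then -((U : UnitAddTorus (Fin 3) → EuclideanSpace ℝ (Fin 3)) x j) else (U : UnitAddTorus (Fin 3) → EuclideanSpace ℝ (Fin 3)) x j))
    (k : Fin 3 → ℤ) : fc U (-k) 0 = -(fc U k 0) := by
  set k1 : Fin 3 → ℤ := Function.update k 0 (-k 0) with hk1
  set k2 : Fin 3 → ℤ := Function.update k1 1 (-k1 1) with hk2
  have e : -k = Function.update k2 2 (-k2 2) := by
    funext l
    fin_cases l <;> simp [hk1, hk2]
  rw [e, fc_update_neg_apply U (hM 2 0) k2, hk2, fc_update_neg_apply U (hM 1 0) k1, hk1,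
    fc_update_neg_apply U (hM 0 0) k]
  simp

/-- **The shell coefficient of a Taylor–Green field**: `a = Û(1,1,1)` has `a₁ = −a₀`, `a₂ = 0` (quarter turn and
mirror) and `Re a₀ = 0` (reality and mirrors). [folklore] -/
theorem fc_one_relations (U : 𝐋)
    (hM : ∀ i j : Fin 3, (fun x => (U : UnitAddTorus (Fin 3) → EuclideanSpace ℝ (Fin 3)) (Function.update x i (-x i)) j) =ᵐ[volume]
      (fun x => if j = i then -((U : UnitAddTorus (Fin 3) → EuclideanSpace ℝ (Fin 3)) x j) else (U : UnitAddTorus (Fin 3) → EuclideanSpace ℝ (Fin 3)) x j))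
    (hQ : (fun x => (U : UnitAddTorus (Fin 3) → EuclideanSpace ℝ (Fin 3)) ![(((1/2 : ℝ)) : UnitAddCircle) - x 1, x 0, x 2]) =ᵐ[volume]
      (fun x => !₂[-((U : UnitAddTorus (Fin 3) → EuclideanSpace ℝ (Fin 3)) x 1), (U : UnitAddTorus (Fin 3) → EuclideanSpace ℝ (Fin 3)) x 0, (U : UnitAddTorus (Fin 3) → EuclideanSpace ℝ (Fin 3)) x 2])) :
    fc U (fun _ => 1) 1 = -(fc U (fun _ => 1) 0) ∧ fc U (fun _ => 1) 2 = 0 ∧ (fc U (fun _ => 1) 0).re = 0 := by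
  obtain ⟨q0, q1, q2⟩ := fc_quarterTurn U hQ (fun _ => 1)
  have e1 : (![-1, 1, 1] : Fin 3 → ℤ) = Function.update (fun _ => (1 : ℤ)) 0 (-1) := by
    funext l
    fin_cases l <;> simp
  have hf : (fourier (-1) (((1/2 : ℝ)) : UnitAddCircle) : ℂ) = -1 := by
    rw [fourier_half]; norm_num
  simp only [e1, hf] at q0 q1 q2
  have m1 := fc_update_neg_apply U (hM 0 1) (fun _ => 1)
  have m2 := fc_update_neg_apply U (hM 0 2) (fun _ => 1)
  simp only [show ((1 : Fin 3) = 0) = False from propext ⟨by decide, False.elim⟩,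
    show ((2 : Fin 3) = 0) = False from propext ⟨by decide, False.elim⟩, if_false, one_mul] at m1 m2
  have hr : conj (fc U (fun _ => 1) 0) = -(fc U (fun _ => 1) 0) := by
    rw [← fc_neg_apply, fc_neg_apply_zero U hM]
  refine ⟨?_, ?_, ?_⟩
  · linear_combination (-1 : ℂ) * m1 - q1
  · linear_combination (-1/2 : ℂ) * q2 + (-1/2 : ℂ) * m2
  · have := congrArg Complex.re hr
    rw [Complex.conj_re, Complex.neg_re] at this
    linarith

/-- `‖a‖² = 2 (Im a₀)²` and `Re⟪f̂(1,1,1), a⟫ = −Im a₀ / 4` for the shell coefficient of a Taylor–Green field. [folklore] -/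
theorem shell_values (U : 𝐋)
    (hM : ∀ i j : Fin 3, (fun x => (U : UnitAddTorus (Fin 3) → EuclideanSpace ℝ (Fin 3)) (Function.update x i (-x i)) j) =ᵐ[volume]
      (fun x => if j = i then -((U : UnitAddTorus (Fin 3) → EuclideanSpace ℝ (Fin 3)) x j) else (U : UnitAddTorus (Fin 3) → EuclideanSpace ℝ (Fin 3)) x j))
    (hQ : (fun x => (U : UnitAddTorus (Fin 3) → EuclideanSpace ℝ (Fin 3)) ![(((1/2 : ℝ)) : UnitAddCircle) - x 1, x 0, x 2]) =ᵐ[volume]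
      (fun x => !₂[-((U : UnitAddTorus (Fin 3) → EuclideanSpace ℝ (Fin 3)) x 1), (U : UnitAddTorus (Fin 3) → EuclideanSpace ℝ (Fin 3)) x 0, (U : UnitAddTorus (Fin 3) → EuclideanSpace ℝ (Fin 3)) x 2])) :
    ‖fc U (fun _ => 1)‖ ^ 2 = 2 * (fc U (fun _ => 1) 0).im ^ 2 ∧
      (inner ℂ (tgCoeff (fun _ => 1)) (fc U (fun _ => 1))).re = -((fc U (fun _ => 1) 0).im) / 4 := by
  obtain ⟨h1, h2, h0⟩ := fc_one_relations U hM hQ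
  constructor
  · rw [EuclideanSpace.norm_sq_eq, Fin.sum_univ_three, h1, h2, norm_neg, norm_zero, Complex.sq_norm, Complex.normSq_apply, h0]
    ring
  · have hI : inner ℂ (tgCoeff (fun _ => 1)) (fc U (fun _ => 1)) = (Complex.I / 4) * fc U (fun _ => 1) 0 := by
      rw [tgCoeff, inner_smul_left, Complex.conj_ofReal, PiLp.inner_apply, Fin.sum_univ_three, h1, h2]
      simp [RCLike.inner_apply]
      ring
    rw [hI, Complex.mul_re, Complex.div_ofNat_re, Complex.div_ofNat_im, Complex.I_re, Complex.I_im, h0]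
    ring

/-- **The shell part of a Taylor–Green field is `4 (U, f_TG) f_TG`**: `Σ_{k ∈ {±1}³} ‖Û(k)‖² = 4 (U, f_TG)²`. [folklore] -/
theorem shell_energy_eq (U : 𝐋)
    (hM : ∀ i j : Fin 3, (fun x => (U : UnitAddTorus (Fin 3) → EuclideanSpace ℝ (Fin 3)) (Function.update x i (-x i)) j) =ᵐ[volume]
      (fun x => if j = i then -((U : UnitAddTorus (Fin 3) → EuclideanSpace ℝ (Fin 3)) x j) else (U : UnitAddTorus (Fin 3) → EuclideanSpace ℝ (Fin 3)) x j))
    (hQ : (fun x => (U : UnitAddTorus (Fin 3) → EuclideanSpace ℝ (Fin 3)) ![(((1/2 : ℝ)) : UnitAddCircle) - x 1, x 0, x 2]) =ᵐ[volume]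
      (fun x => !₂[-((U : UnitAddTorus (Fin 3) → EuclideanSpace ℝ (Fin 3)) x 1), (U : UnitAddTorus (Fin 3) → EuclideanSpace ℝ (Fin 3)) x 0, (U : UnitAddTorus (Fin 3) → EuclideanSpace ℝ (Fin 3)) x 2])) :
    ∑ k ∈ tgShell, ‖fc U k‖ ^ 2 = 4 * (Literature.Analysis.FluidPDE.Torus.pairing U tgForce) ^ 2 := by
  obtain ⟨hn, hi⟩ := shell_values U hM hQ
  have hD : Literature.Analysis.FluidPDE.Torus.pairing U tgForce = ∑ k ∈ tgShell, (inner ℂ (tgCoeff k) (fc U k)).re := by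
    unfold fc
    rw [← integral_inner_tgForce_eq_sum (Lp.memLp U), Literature.Analysis.FluidPDE.Torus.pairing]
    exact integral_congr_ae (ae_of_all _ fun x => real_inner_comm _ _)
  have hS : ∑ k ∈ tgShell, ‖fc U k‖ ^ 2 = 8 • ‖fc U (fun _ => 1)‖ ^ 2 :=
    sum_tgShell_eq_of_flip_invariant (fun k => ‖fc U k‖ ^ 2) fun i k => by
      show ‖fc U (Function.update k i (-k i))‖ ^ 2 = ‖fc U k‖ ^ 2
      rw [norm_fc_update_neg U hM i k]
  have hP : ∑ k ∈ tgShell, (inner ℂ (tgCoeff k) (fc U k)).re = 8 • (inner ℂ (tgCoeff (fun _ => 1)) (fc U (fun _ => 1))).re :=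
    sum_tgShell_eq_of_flip_invariant (fun k => (inner ℂ (tgCoeff k) (fc U k)).re) fun i k => by
      show (inner ℂ (tgCoeff (Function.update k i (-k i))) (fc U (Function.update k i (-k i)))).re = (inner ℂ (tgCoeff k) (fc U k)).re
      rw [inner_tgCoeff_fc_update_neg U hM i k]
  rw [hS, hD, hP, nsmul_eq_mul, nsmul_eq_mul, hn, hi]
  push_cast
  ring

end Summit.AnomalousDissipation.AnomalousDissipation.Theorems.DegreeGate

end
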